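import Summits.NavierStokesRegularity.NavierStokesRegularity.Theses.AxisymmetricExtremality
import Summits.NavierStokesRegularity.NavierStokesRegularity.Theorems.AxisymmetricExtremalityAxisymmetricKatoGlobalStubSereginLogSwirlOriginCoreNormaliseTransport
import Summits.NavierStokesRegularity.NavierStokesRegularity.Theorems.AxisymmetricExtremalityAxisymmetricKatoGlobalStubSereginLogSwirlOriginFinalReduction
import Summits.NavierStokesRegularity.NavierStokesRegularity.Theorems.AxisymmetricExtremalityAxisymmetricKatoGlobalStubSereginLogSwirlOriginStep4AssemblyParts
import Summits.NavierStokesRegularity.NavierStokesRegularity.Theorems.AxisymmetricExtremalityAxisymmetricKatoGlobalStubAxisBoundedOfLocalEnergyOrigin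
import HarnessLib

/-!
# Seregin 2022, §2: normalisation of the classical core of the local regularity criterion to the
# origin at unit scale —
# crux stmt-NavierStokesRegularity-15453 (`AxisymmetricExtremality.AxisymmetricKatoGlobal`), line registered, support for stub `stub_sereginLogSwirlOrigin`

Support file (`--supports stmt-NavierStokesRegularity-15453`; theorems only, everything proved)
toward the registered stub `stub_sereginLogSwirlOrigin` = the named fact
`Literature.Analysis.FluidPDE.seregin2022_logSwirl_regularAtOrigin` (G. Seregin, J. Math. Fluid
Mech. 24 (2022), Paper 27 = arXiv:2201.00153, §2: Def. 1.1 in `Q = 𝒞 × ]-1, 0[` + axial symmetry +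
the swirl bound (2.2) ⇒ the origin is a regular point).  Third of three files (siblings
`…CoreNormaliseRescale`, `…CoreNormaliseTransport`).

The sibling `…FinalReduction` reduced the fact to ONE written-out hypothesis `core`
(`seregin2022_logSwirl_regularAtOrigin_of_cleanRepr`): Steps 2–4 of the printed proof for the
Seregin–Zajaczkowski representative `V` of `v` on the clean slab `Q(ẑ, R)` around an arbitrary axis
point `ẑ = (t̂, x̂)` (`-1/16 < t̂ ≤ 0`, `|x̂₃| ≤ 1/4`) at an arbitrary scale `0 < R ≤ 1/4`, with two
regular heights `h±` and a width `δ`.  The printed Steps 2–4 are written at the origin of `Q` at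
unit scale ("in `Q`", cut-off `η = φ(r)ψ(x₃)ξ(t)` in `𝒞 × ]-1, 0[`).  This file performs the
normalisation: `core_of_core_at_origin` (registered) derives `core` from the CORE AT THE ORIGIN —
the same statement at `ẑ = 0`, `R = 1`, for a pair `(u, π)` in the class (H) of the fact on `Q` and
a representative `W` in `IsSmoothAxisymmetricSolutionOn Q W π` with the derivative bounds up to the
top time off the axis and in the strips `|y₃ - h±| < δ`, supplemented by the two pointwise
consequences of the a.e. data that the continuous `W` inherits (`swirlBound_repr`: (2.2) for `W` on
`Q` off the axis; `energyBound_repr`: `∫_𝒞 |W(s)|² ≤ A` at every time, by Fubini and Fatou) — by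
translating `ẑ` to the origin and rescaling parabolically (`u = R v ∘ Φ`, `π = R² q ∘ Φ`,
`W = R V ∘ Φ`, `Φ(s, y) = (t̂ + R² s, b e₃ + R y)`, `x̂ = b e₃`; the transports of the siblings), and
`seregin2022_logSwirl_regularAtOrigin_of_coreAtOrigin` composes with the first-singular-time
reduction: **the named fact follows from the core at the origin.**

## References

* G. Seregin, J. Math. Fluid Mech. 24 (2022), Paper No. 27 = arXiv:2201.00153, §2 proof of
  Thm. 1.2, Steps 1–4 (arXiv pp. 5–7). [`Seregin2022LocalAxisym`]
* G. Seregin, V. Šverák, Comm. PDE 34 (2009) = arXiv:0804.1803, §3 (regular points, the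
  scale-invariant setting). [`SereginSverak2009`]
-/

-- the problem directory repeats the summit name (D-0017); core's `dupNamespace` linter fires
set_option linter.dupNamespace false

noncomputable section

open MeasureTheory Set Function Filter Topology TopologicalSpace Metric
open scoped NNReal ENNReal

namespace Summit.NavierStokesRegularity.NavierStokesRegularity.Theorems.AxisymmetricKatoGlobal.EulerScaling

open Literature.Analysis.FluidPDE Literature.Analysis.FluidPDE.SereginZajaczkowski2007
  Literature.Analysis.FluidPDE.SereginSverak2009

/-! ### At the origin: the a.e. data seen by the smooth representative -/

section Repr

variable {u W : ℝ → EuclideanSpace ℝ (Fin 3) → EuclideanSpace ℝ (Fin 3)} {π : ℝ → EuclideanSpace ℝ (Fin 3) → ℝ}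

/-- **The swirl bound (2.2) holds pointwise for the smooth representative on the open slab off the
axis**: `u = W` a.e. on `Q(0, 1)` and `|σ_u(s, y)| ≤ C₁/ln³(e/|y'|)` for all `s`, `y` give the same
bound for `σ_W` a.e. on the open set `Q(0,1) ∩ {|y'| > 0}`, where both sides are continuous
(`W` is jointly continuous on the slab), hence everywhere there
(accepted `forall_le_of_ae_le_of_continuousOn`). [cite: Seregin2022LocalAxisym, (2.2) and §2 Step 3 (the bound is used for the smooth solution on `supp η`, arXiv:2201.00153 pp. 5–7)] -/
theorem swirlBound_repr (hW : IsSmoothAxisymmetricSolutionOn (parCylOpens 0 1) W π)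
    (hae : uncurry u =ᵐ[volume.restrict (parCyl (0 : ℝ × EuclideanSpace ℝ (Fin 3)) 1)] uncurry W)
    (hσ : ∃ C₁ : ℝ, 0 ≤ C₁ ∧ ∀ s ∈ Ioo (-1 : ℝ) 0, ∀ y ∈ spaceCyl 0 1, 0 < cylRadius y →
      |swirl (u s) y| ≤ C₁ / Real.log (Real.exp 1 / cylRadius y) ^ 3) :
    ∃ C₁ : ℝ, 0 ≤ C₁ ∧ ∀ z ∈ parCyl (0 : ℝ × EuclideanSpace ℝ (Fin 3)) 1, 0 < cylRadius z.2 →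
      |swirl (W z.1) z.2| ≤ C₁ / Real.log (Real.exp 1 / cylRadius z.2) ^ 3 := by
  obtain ⟨C₁, hC₁0, hC₁⟩ := hσ
  refine ⟨C₁, hC₁0, ?_⟩
  set U : Set (ℝ × EuclideanSpace ℝ (Fin 3)) :=
    parCyl (0 : ℝ × EuclideanSpace ℝ (Fin 3)) 1 ∩ {z | 0 < cylRadius z.2} with hU
  have hUo : IsOpen U :=
    (isOpen_parCyl 0 1).inter (isOpen_lt continuous_const (continuous_cylRadius.comp continuous_snd))
  have hcW : ContinuousOn (uncurry W) (parCyl (0 : ℝ × EuclideanSpace ℝ (Fin 3)) 1) := hW.continuousOn_velocity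
  have hci : ∀ i : Fin 3, ContinuousOn (fun z : ℝ × EuclideanSpace ℝ (Fin 3) => W z.1 z.2 i) U := fun i =>
    ((EuclideanSpace.proj i).continuous.comp_continuousOn hcW).mono inter_subset_left
  have hyi : ∀ i : Fin 3, Continuous fun z : ℝ × EuclideanSpace ℝ (Fin 3) => z.2 i := fun i =>
    (EuclideanSpace.proj i).continuous.comp continuous_snd
  have hf : ContinuousOn (fun z : ℝ × EuclideanSpace ℝ (Fin 3) => |swirl (W z.1) z.2|) U := by
    have h : ContinuousOn (fun z : ℝ × EuclideanSpace ℝ (Fin 3) => z.2 0 * W z.1 z.2 1 - z.2 1 * W z.1 z.2 0) U :=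
      (((hyi 0).continuousOn.mul (hci 1)).sub ((hyi 1).continuousOn.mul (hci 0)))
    exact h.abs
  have he : (1 : ℝ) < Real.exp 1 := by
    have := Real.add_one_lt_exp (one_ne_zero (α := ℝ))
    linarith
  have hlogpos : ∀ z ∈ U, 0 < Real.log (Real.exp 1 / cylRadius z.2) := by
    intro z hz
    have hz1 : cylRadius z.2 < 1 := ((mem_parCyl_zero.1 hz.1).2).1
    apply Real.log_pos
    rw [lt_div_iff₀ hz.2]
    nlinarith
  have hg : ContinuousOn (fun z : ℝ × EuclideanSpace ℝ (Fin 3) => C₁ / Real.log (Real.exp 1 / cylRadius z.2) ^ 3) U := by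
    refine continuousOn_const.div ?_ fun z hz => (pow_pos (hlogpos z hz) 3).ne'
    refine ((continuousOn_const.div (continuous_cylRadius.comp continuous_snd).continuousOn
      fun z hz => (ne_of_gt hz.2)).log fun z hz => ?_).pow 3
    exact (div_pos (Real.exp_pos 1) hz.2).ne'
  have hle : ∀ᵐ z ∂(volume.restrict U), |swirl (W z.1) z.2| ≤ C₁ / Real.log (Real.exp 1 / cylRadius z.2) ^ 3 := by
    have hae' : ∀ᵐ z ∂(volume.restrict U), uncurry u z = uncurry W z :=
      ae_restrict_of_ae_restrict_of_subset inter_subset_left hae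
    filter_upwards [hae', ae_restrict_mem hUo.measurableSet] with z hz hzU
    have hzQ := mem_parCyl_zero.1 hzU.1
    have hswirl : swirl (W z.1) z.2 = swirl (u z.1) z.2 := by
      have e : W z.1 z.2 = u z.1 z.2 := by
        have := hz; simp only [uncurry] at this; exact this.symm
      simp only [swirl, e]
    rw [hswirl]
    refine hC₁ z.1 ?_ z.2 (mem_spaceCyl_zero_iff.2 hzQ.2) hzU.2
    simpa using hzQ.1
  intro z hz hz0
  exact forall_le_of_ae_le_of_continuousOn hUo hf hg hle z ⟨hz, hz0⟩

/-- The time slices of `Q(0, 1)`: `(s, y) ∈ Q(0, 1)` iff `-1 < s < 0` and `y ∈ 𝒞`. [folklore] -/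
theorem mk_mem_parCyl_zero_one {s : ℝ} {y : EuclideanSpace ℝ (Fin 3)} :
    ((s, y) : ℝ × EuclideanSpace ℝ (Fin 3)) ∈ parCyl (0 : ℝ × EuclideanSpace ℝ (Fin 3)) 1 ↔
      s ∈ Ioo (-1 : ℝ) 0 ∧ y ∈ spaceCyl (0 : EuclideanSpace ℝ (Fin 3)) 1 := by
  rw [mem_parCyl_zero, mem_spaceCyl_zero_iff]
  simp

/-- **The energy class of the smooth representative, at every time.** If `u = W` a.e. on `Q(0, 1)`,
`∫_𝒞 |u(s)|² ≤ C` for a.e. `s ∈ ]-1, 0[` and `W` is jointly continuous on the slab, then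
`∫_𝒞 |W(s)|² ≤ C` for EVERY `s ∈ ]-1, 0[`: by Fubini `W(s) = u(s)` a.e. for a.e. `s`, so the bound
holds on a dense set of times, and Fatou's lemma along `s_k → s` (pointwise convergence
`W(s_k, y) → W(s, y)`) gives it everywhere. [folklore] -/
theorem energyBound_repr (hW : IsSmoothAxisymmetricSolutionOn (parCylOpens 0 1) W π)
    (hae : uncurry u =ᵐ[volume.restrict (parCyl (0 : ℝ × EuclideanSpace ℝ (Fin 3)) 1)] uncurry W)
    (hA : ∃ C : ℝ≥0, ∀ᵐ s ∂(volume.restrict (Ioo (-1 : ℝ) 0)),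
      ∫⁻ y in spaceCyl 0 1, ‖u s y‖ₑ ^ 2 ≤ C) :
    ∃ A : ℝ≥0, ∀ s ∈ Ioo (-1 : ℝ) 0, ∫⁻ y in spaceCyl 0 1, ‖W s y‖ₑ ^ 2 ≤ A := by
  obtain ⟨C, hC⟩ := hA
  refine ⟨C, fun s hs => ?_⟩
  have hcW : ContinuousOn (uncurry W) (parCyl (0 : ℝ × EuclideanSpace ℝ (Fin 3)) 1) := hW.continuousOn_velocity
  -- Fubini: `u(s) = W(s)` a.e. on `𝒞` for a.e. `s`
  have hprod : (volume.restrict (Ioo (-1 : ℝ) 0)).prod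
      (volume.restrict (spaceCyl (0 : EuclideanSpace ℝ (Fin 3)) 1)) =
      volume.restrict (parCyl (0 : ℝ × EuclideanSpace ℝ (Fin 3)) 1) := by
    rw [Measure.prod_restrict, ← Measure.volume_eq_prod, parCyl_zero_eq_prod]
    norm_num
  have hae2 : ∀ᵐ s ∂(volume.restrict (Ioo (-1 : ℝ) 0)),
      u s =ᵐ[volume.restrict (spaceCyl (0 : EuclideanSpace ℝ (Fin 3)) 1)] W s := by
    apply Measure.ae_ae_eq_of_ae_eq_uncurry
    rw [hprod]
    exact hae
  have hgood : ∀ᵐ s ∂(volume.restrict (Ioo (-1 : ℝ) 0)),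
      ∫⁻ y in spaceCyl 0 1, ‖W s y‖ₑ ^ 2 ≤ C := by
    filter_upwards [hC, hae2] with s hs hs2
    calc ∫⁻ y in spaceCyl 0 1, ‖W s y‖ₑ ^ 2 = ∫⁻ y in spaceCyl 0 1, ‖u s y‖ₑ ^ 2 :=
        lintegral_congr_ae (by filter_upwards [hs2] with y hy; rw [hy])
      _ ≤ C := hs
  -- the good times are dense: a sequence of good times `s_k → s`
  set G : Set ℝ := {s' | s' ∈ Ioo (-1 : ℝ) 0 → ∫⁻ y in spaceCyl 0 1, ‖W s' y‖ₑ ^ 2 ≤ C} with hG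
  have hGd : Dense G := Measure.dense_of_ae (μ := volume) ((ae_restrict_iff' measurableSet_Ioo).1 hgood)
  have hcl : s ∈ closure (Ioo (-1 : ℝ) 0 ∩ G) := hGd.open_subset_closure_inter isOpen_Ioo hs
  obtain ⟨sq, hsqG, hsqt⟩ := mem_closure_iff_seq_limit.1 hcl
  have hgoodk : ∀ k, ∫⁻ y in spaceCyl 0 1, ‖W (sq k) y‖ₑ ^ 2 ≤ C := fun k => (hsqG k).2 (hsqG k).1
  -- pointwise convergence on `𝒞` by the joint continuity of `W`
  have hlim : ∀ y ∈ spaceCyl (0 : EuclideanSpace ℝ (Fin 3)) 1,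
      Tendsto (fun k => ‖W (sq k) y‖ₑ ^ 2) atTop (𝓝 (‖W s y‖ₑ ^ 2)) := by
    intro y hy
    have hcont : ContinuousWithinAt (uncurry W) (parCyl (0 : ℝ × EuclideanSpace ℝ (Fin 3)) 1) (s, y) :=
      hcW (s, y) (mk_mem_parCyl_zero_one.2 ⟨hs, hy⟩)
    have hseq : Tendsto (fun k => ((sq k, y) : ℝ × EuclideanSpace ℝ (Fin 3))) atTop
        (𝓝[parCyl (0 : ℝ × EuclideanSpace ℝ (Fin 3)) 1] (s, y)) :=
      tendsto_nhdsWithin_iff.2 ⟨hsqt.prodMk_nhds tendsto_const_nhds,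
        Eventually.of_forall fun k => mk_mem_parCyl_zero_one.2 ⟨(hsqG k).1, hy⟩⟩
    have h1 : Tendsto (fun k => W (sq k) y) atTop (𝓝 (W s y)) := hcont.tendsto.comp hseq
    exact ENNReal.Tendsto.pow ((continuous_enorm.tendsto _).comp h1)
  -- the slices of `W` are continuous on `𝒞`, hence a.e.-measurable there
  have hmeas : ∀ k, AEMeasurable (fun y => ‖W (sq k) y‖ₑ ^ 2)
      (volume.restrict (spaceCyl (0 : EuclideanSpace ℝ (Fin 3)) 1)) := by
    intro k
    have hsl : ContinuousOn (W (sq k)) (spaceCyl (0 : EuclideanSpace ℝ (Fin 3)) 1) :=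
      hcW.comp (Continuous.continuousOn (by fun_prop)) fun y hy => mk_mem_parCyl_zero_one.2 ⟨(hsqG k).1, hy⟩
    exact ((hsl.aemeasurable (isOpen_spaceCyl 0 1).measurableSet).enorm.pow_const 2)
  -- Fatou
  calc ∫⁻ y in spaceCyl 0 1, ‖W s y‖ₑ ^ 2
      = ∫⁻ y in spaceCyl 0 1, liminf (fun k => ‖W (sq k) y‖ₑ ^ 2) atTop :=
        setLIntegral_congr_fun (isOpen_spaceCyl 0 1).measurableSet fun y hy => ((hlim y hy).liminf_eq).symm
    _ ≤ liminf (fun k => ∫⁻ y in spaceCyl 0 1, ‖W (sq k) y‖ₑ ^ 2) atTop := lintegral_liminf_le' hmeas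
    _ ≤ C := liminf_le_of_frequently_le' (Frequently.of_forall hgoodk)

end Repr

/-! ### The normalisation of the core -/

section Core

/-- **Seregin 2022, §2: the classical core of the criterion, normalised to the origin at unit
scale, implies the core at every axis point and scale.** The CORE AT THE ORIGIN `hnorm` is the
hypothesis `core` of `seregin2022_logSwirl_regularAtOrigin_of_cleanRepr` (sibling `…FinalReduction`)
written at `ẑ = 0`, `R = 1`: for every pair `(u, π)` in the class (H) of the fact on
`Q = 𝒞 × ]-1, 0[` (suitable weak solution of the unit-viscosity system, `u ∈ L_{2,∞}`,
`∇u ∈ L₂`, `π ∈ L_{3/2}`, axisymmetric slices, swirl bound (2.2) with `C₁ ≥ 0`), heights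
`-1 ≤ h₋ - δ`, `h₋ + δ < 0 < h₊ - δ`, `h₊ + δ ≤ 1`, and a representative `W` of `u` on `Q` in the
Seregin–Zajaczkowski class `IsSmoothAxisymmetricSolutionOn Q W π` whose spatial derivatives of every
order are bounded up to the top time near each top-slice point `a ∈ 𝒞` off the axis or with
`|a₃ - h±| < δ` (on some `Q_ρ(0, a) ⊆ Q`), supplemented by the two pointwise consequences of the a.e.
data for the continuous `W` — the swirl bound (2.2) for `W` on `Q` off the axis and the energy bound
`∫_𝒞 |W(s)|² ≤ A` at EVERY time (`swirlBound_repr`, `energyBound_repr`) — the origin is a regular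
point of `u` (`IsRegularAtOrigin u`; this is what Steps 2–4 of the printed proof establish, the
proof being written "in `Q`"). CONCLUSION: the core at a general configuration `(ẑ, R, h±, δ, V)`,
verbatim. PROOF: translate `ẑ = (t̂, b e₃)` to the origin and rescale parabolically,
`u = R v ∘ Φ`, `π = R² q ∘ Φ`, `W = R V ∘ Φ`, `Φ(s, y) = (t̂ + R² s, b e₃ + R y)`: the class (H) is
covariant (`suitable_axisZoom`, `energyClass_axisZoom`, `gradClass_axisZoom`,
`pressureClass_axisZoom`, `isAxisymmetric_axisZoom`, `isAxisymmetricScalar_axisZoom`; the swirl is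
scale invariant and the logarithmic weight monotone, `swirlBound_axisZoom`), the
Seregin–Zajaczkowski class is covariant (`isSmoothAxisymmetricSolutionOn_axisZoom`) with
`Φ⁻¹(Q(ẑ, R)) = Q`, `v = V` a.e. transports (`aeEq_axisZoom`), the heights become `(h± - b)/R`,
`δ/R` and the derivative bounds scale by `R^{n+1}` (`derivBounds_axisZoom`); regularity of the origin
for `u` is an `L_∞` bound of `v` on `Q_{Rr}(ẑ)` (`backwardRegular_of_axisZoom`).
[cite: Seregin2022LocalAxisym, §2 proof of Thm. 1.2 ("Let us consider the following Cauchy problem … in `Q`"; Steps 1–4, arXiv:2201.00153 pp. 5–7)] -/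
theorem core_of_core_at_origin : (∀ (u : ℝ → EuclideanSpace ℝ (Fin 3) → EuclideanSpace ℝ (Fin 3)) (π : ℝ → EuclideanSpace ℝ (Fin 3) → ℝ), IsSuitableWeakSolutionOn (SereginSverak2009.parCylOpens 0 1) 1 0 u π → (∃ C : ℝ≥0, ∀ᵐ s ∂(volume.restrict (Ioo (-1 : ℝ) 0)), ∫⁻ y in SereginSverak2009.spaceCyl 0 1, ‖u s y‖ₑ ^ 2 ≤ C) → (∃ G : ℝ → EuclideanSpace ℝ (Fin 3) → EuclideanSpace ℝ (Fin 3) →L[ℝ] EuclideanSpace ℝ (Fin 3), HasWeakSpatialGradientOn (SereginSverak2009.parCylOpens 0 1) u G ∧ ∫⁻ z in SereginSverak2009.parCyl 0 1, ENNReal.ofReal (frobeniusNormSq (G z.1 z.2)) < ∞) → (∫⁻ z in SereginSverak2009.parCyl 0 1, ‖π z.1 z.2‖ₑ ^ (3 / 2 : ℝ) < ∞) → (∀ s ∈ Ioo (-1 : ℝ) 0, IsAxisymmetric (u s)) → (∀ s ∈ Ioo (-1 : ℝ) 0, IsAxisymmetricScalar (π s)) → (∃ C₁ : ℝ, 0 ≤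 C₁ ∧ ∀ s ∈ Ioo (-1 : ℝ) 0, ∀ y ∈ SereginSverak2009.spaceCyl 0 1, 0 < cylRadius y → |swirl (u s) y| ≤ C₁ / Real.log (Real.exp 1 / cylRadius y) ^ 3) → ∀ (hp hm δ : ℝ) (W : ℝ → EuclideanSpace ℝ (Fin 3) → EuclideanSpace ℝ (Fin 3)), SereginZajaczkowski2007.IsSmoothAxisymmetricSolutionOn (SereginSverak2009.parCylOpens 0 1) W π → uncurry u =ᵐ[volume.restrict (SereginSverak2009.parCyl 0 1)] uncurry W → 0 < δ → -1 ≤ hm - δ → hm + δ < 0 → 0 < hp - δ → hp + δ ≤ 1 → (∀ a ∈ SereginSverak2009.spaceCyl (0 : EuclideanSpace ℝ (Fin 3)) 1, (0 < cylRadius a ∨ |a 2 - hp| < δ ∨ |a 2 - hm| < δ) → ∃ ρ > 0, parabolicCylinder ρ (((0 : ℝ), a) : ℝ × EuclideanSpace ℝ (Fin 3)) ⊆ SereginSverak2009.parCyl 0 1 ∧ ∀ n : ℕ, ∃ C : ℝ, ∀ w ∈ parabolicCylinder ρ (((0 : ℝ), a) : ℝ × EuclideanSpace ℝ (Fin 3)),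 ‖iteratedFDeriv ℝ n (W w.1) w.2‖ ≤ C) → (∃ C₁ : ℝ, 0 ≤ C₁ ∧ ∀ z ∈ SereginSverak2009.parCyl (0 : ℝ × EuclideanSpace ℝ (Fin 3)) 1, 0 < cylRadius z.2 → |swirl (W z.1) z.2| ≤ C₁ / Real.log (Real.exp 1 / cylRadius z.2) ^ 3) → (∃ A : ℝ≥0, ∀ s ∈ Ioo (-1 : ℝ) 0, ∫⁻ y in SereginSverak2009.spaceCyl 0 1, ‖W s y‖ₑ ^ 2 ≤ A) → SereginSverak2009.IsRegularAtOrigin u) → ∀ (v : ℝ → EuclideanSpace ℝ (Fin 3) → EuclideanSpace ℝ (Fin 3)) (q : ℝ → EuclideanSpace ℝ (Fin 3) → ℝ), IsSuitableWeakSolutionOn (SereginSverak2009.parCylOpens 0 1) 1 0 v q → (∃ C : ℝ≥0, ∀ᵐ t ∂(volume.restrict (Ioo (-1 : ℝ) 0)), ∫⁻ x in SereginSverak2009.spaceCyl 0 1, ‖v t x‖ₑ ^ 2 ≤ C) → (∃ G : ℝ → EuclideanSpace ℝ (Fin 3) → EuclideanSpace ℝ (Fin 3) →L[ℝ] EuclideanSpace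 ℝ (Fin 3), HasWeakSpatialGradientOn (SereginSverak2009.parCylOpens 0 1) v G ∧ ∫⁻ z in SereginSverak2009.parCyl 0 1, ENNReal.ofReal (frobeniusNormSq (G z.1 z.2)) < ∞) → (∫⁻ z in SereginSverak2009.parCyl 0 1, ‖q z.1 z.2‖ₑ ^ (3 / 2 : ℝ) < ∞) → (∀ t ∈ Ioo (-1 : ℝ) 0, IsAxisymmetric (v t)) → (∀ t ∈ Ioo (-1 : ℝ) 0, IsAxisymmetricScalar (q t)) → (∃ C₁ : ℝ, ∀ t ∈ Ioo (-1 : ℝ) 0, ∀ x ∈ SereginSverak2009.spaceCyl 0 1, 0 < cylRadius x → |swirl (v t) x| ≤ C₁ / Real.log (Real.exp 1 / cylRadius x) ^ 3) → ∀ (zc : ℝ × EuclideanSpace ℝ (Fin 3)) (R hp hm δ : ℝ) (V : ℝ → EuclideanSpace ℝ (Fin 3) → EuclideanSpace ℝ (Fin 3)), zc.1 ∈ Ioc (-1 / 16 : ℝ) 0 → cylRadius zc.2 = 0 → |zc.2 2| ≤ 1 / 4 → 0 < R → R ≤ 1 / 4 → SereginZajaczkowski2007.IsSmoothAxisymmetricSolutionOn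 (SereginSverak2009.parCylOpens zc R) V q → uncurry v =ᵐ[volume.restrict (SereginSverak2009.parCyl zc R)] uncurry V → 0 < δ → zc.2 2 - R ≤ hm - δ → hm + δ < zc.2 2 → zc.2 2 < hp - δ → hp + δ ≤ zc.2 2 + R → (∀ a ∈ SereginSverak2009.spaceCyl zc.2 R, (0 < cylRadius a ∨ |a 2 - hp| < δ ∨ |a 2 - hm| < δ) → ∃ ρ > 0, parabolicCylinder ρ ((zc.1, a) : ℝ × EuclideanSpace ℝ (Fin 3)) ⊆ SereginSverak2009.parCyl zc R ∧ ∀ n : ℕ, ∃ C : ℝ, ∀ w ∈ parabolicCylinder ρ ((zc.1, a) : ℝ × EuclideanSpace ℝ (Fin 3)), ‖iteratedFDeriv ℝ n (V w.1) w.2‖ ≤ C) → ∃ r > 0, eLpNorm (uncurry v) ∞ (volume.restrict (parabolicCylinder r zc)) < ∞ := by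
  rintro hnorm v q hsw hA hG hq hv_ax hq_ax hσ ⟨t₀, xc⟩ R hp hm δ V h1 h2 h3 h4 h5 hV hae h7 h8 h9 h10
    h11 hbd
  dsimp only at h1 h2 h3 hV hae h8 h9 h10 h11 hbd ⊢
  -- the centre is `b e₃`
  set b : ℝ := xc 2 with hb_def
  have hx : xc = b • eZ := by
    rw [hb_def]; exact Registered.eq_smul_eZ_of_cylRadius_eq_zero h2
  clear_value b
  subst hx
  -- the rescaled data at the origin
  have hW : IsSmoothAxisymmetricSolutionOn (parCylOpens 0 1) (R • stPull (R ^ 2) R t₀ (b • eZ) V)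
      (R ^ 2 • stPull (R ^ 2) R t₀ (b • eZ) q) := by
    have h := isSmoothAxisymmetricSolutionOn_axisZoom _ _ _ hV R t₀ b h4
    rwa [parCylOpens_axisZoom h4] at h
  have haeW := aeEq_axisZoom h4 hae
  have hAu := energyClass_axisZoom hA h1 h3 h4 h5
  have hσu := swirlBound_axisZoom v t₀ b R h1 h3 h4 h5 hσ
  obtain ⟨hδ', hm1, hm2, hp1, hp2⟩ := heights_axisZoom h4 h7 h8 h9 h10 h11
  have hreg := hnorm (R • stPull (R ^ 2) R t₀ (b • eZ) v) (R ^ 2 • stPull (R ^ 2) R t₀ (b • eZ) q)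
    (suitable_axisZoom hsw h1 h3 h4 h5) hAu (gradClass_axisZoom hG h1 h3 h4 h5)
    (pressureClass_axisZoom hq h1 h3 h4 h5) (isAxisymmetric_axisZoom hv_ax h1 h4 h5)
    (isAxisymmetricScalar_axisZoom hq_ax h1 h4 h5) hσu ((hp - b) / R) ((hm - b) / R) (δ / R)
    (R • stPull (R ^ 2) R t₀ (b • eZ) V) hW haeW hδ' hm1 hm2 hp1 hp2
    (derivBounds_axisZoom h4 hV.contDiffAt hbd) (swirlBound_repr hW haeW hσu)
    (energyBound_repr hW haeW hAu)
  exact backwardRegular_of_axisZoom h4 t₀ (b • eZ) (isRegularAtOrigin_iff_backwardRegular_zero.1 hreg)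

/-- **The named fact from the core at the origin.** Composing `core_of_core_at_origin` with the
first-singular-time reduction `seregin2022_logSwirl_regularAtOrigin_of_cleanRepr`
(sibling `…FinalReduction`): if Steps 2–4 of the printed proof hold in their printed setting — the
origin of `Q = 𝒞 × ]-1, 0[` at unit scale, for the Seregin–Zajaczkowski representative with
derivative bounds up to the top time off the axis and near two heights — then Seregin's local
regularity criterion `seregin2022_logSwirl_regularAtOrigin` holds.
[cite: Seregin2022LocalAxisym, §2 proof of Thm. 1.2, Steps 1–4 (arXiv:2201.00153 pp. 5–7)] -/
theorem seregin2022_logSwirl_regularAtOrigin_of_coreAtOrigin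
    (hnorm : ∀ (u : ℝ → EuclideanSpace ℝ (Fin 3) → EuclideanSpace ℝ (Fin 3))
      (π : ℝ → EuclideanSpace ℝ (Fin 3) → ℝ),
      IsSuitableWeakSolutionOn (SereginSverak2009.parCylOpens 0 1) 1 0 u π →
      (∃ C : ℝ≥0, ∀ᵐ s ∂(volume.restrict (Ioo (-1 : ℝ) 0)),
        ∫⁻ y in SereginSverak2009.spaceCyl 0 1, ‖u s y‖ₑ ^ 2 ≤ C) →
      (∃ G : ℝ → EuclideanSpace ℝ (Fin 3) → EuclideanSpace ℝ (Fin 3) →L[ℝ] EuclideanSpace ℝ (Fin 3),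
        HasWeakSpatialGradientOn (SereginSverak2009.parCylOpens 0 1) u G ∧
          ∫⁻ z in SereginSverak2009.parCyl 0 1, ENNReal.ofReal (frobeniusNormSq (G z.1 z.2)) < ∞) →
      (∫⁻ z in SereginSverak2009.parCyl 0 1, ‖π z.1 z.2‖ₑ ^ (3 / 2 : ℝ) < ∞) →
      (∀ s ∈ Ioo (-1 : ℝ) 0, IsAxisymmetric (u s)) →
      (∀ s ∈ Ioo (-1 : ℝ) 0, IsAxisymmetricScalar (π s)) →
      (∃ C₁ : ℝ, 0 ≤ C₁ ∧ ∀ s ∈ Ioo (-1 : ℝ) 0, ∀ y ∈ SereginSverak2009.spaceCyl 0 1, 0 < cylRadius y →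
        |swirl (u s) y| ≤ C₁ / Real.log (Real.exp 1 / cylRadius y) ^ 3) →
      ∀ (hp hm δ : ℝ) (W : ℝ → EuclideanSpace ℝ (Fin 3) → EuclideanSpace ℝ (Fin 3)),
        SereginZajaczkowski2007.IsSmoothAxisymmetricSolutionOn (SereginSverak2009.parCylOpens 0 1) W π →
        uncurry u =ᵐ[volume.restrict (SereginSverak2009.parCyl 0 1)] uncurry W →
        0 < δ → -1 ≤ hm - δ → hm + δ < 0 → 0 < hp - δ → hp + δ ≤ 1 →
        (∀ a ∈ SereginSverak2009.spaceCyl (0 : EuclideanSpace ℝ (Fin 3)) 1,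
          (0 < cylRadius a ∨ |a 2 - hp| < δ ∨ |a 2 - hm| < δ) →
          ∃ ρ > 0, parabolicCylinder ρ (((0 : ℝ), a) : ℝ × EuclideanSpace ℝ (Fin 3)) ⊆
              SereginSverak2009.parCyl 0 1 ∧
            ∀ n : ℕ, ∃ C : ℝ, ∀ w ∈ parabolicCylinder ρ (((0 : ℝ), a) : ℝ × EuclideanSpace ℝ (Fin 3)),
              ‖iteratedFDeriv ℝ n (W w.1) w.2‖ ≤ C) →
        (∃ C₁ : ℝ, 0 ≤ C₁ ∧ ∀ z ∈ SereginSverak2009.parCyl (0 : ℝ × EuclideanSpace ℝ (Fin 3)) 1,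
          0 < cylRadius z.2 → |swirl (W z.1) z.2| ≤ C₁ / Real.log (Real.exp 1 / cylRadius z.2) ^ 3) →
        (∃ A : ℝ≥0, ∀ s ∈ Ioo (-1 : ℝ) 0, ∫⁻ y in SereginSverak2009.spaceCyl 0 1, ‖W s y‖ₑ ^ 2 ≤ A) →
        SereginSverak2009.IsRegularAtOrigin u) :
    seregin2022_logSwirl_regularAtOrigin :=
  seregin2022_logSwirl_regularAtOrigin_of_cleanRepr (core_of_core_at_origin hnorm)

end Core

end Summit.NavierStokesRegularity.NavierStokesRegularity.Theorems.AxisymmetricKatoGlobal.EulerScaling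

end
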